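import Mathlib
import Summits.CriticalPhenomena.SAWScalingLimit.Theorems.SAWExcursionCardyCardyFSpecSeries
import HarnessLib

/-!
# Term-wise differentiation and the hypergeometric equation of `₂F₁(-1/2, 2; 7/2; ·)` —
helper file 2 for item `CardyFSpec` (route `SAWExcursionCardy`, stmt-CriticalPhenomena-4516)

For `w = ₂F₁(-1/2, 2; 7/2; ·) = ∑ c_n uⁿ` (coefficients `c_n`, `|c_n| ≤ 1`, helper file 1) and
`|r| < 1`:

* `w` is differentiable with derivative the term-wise series `W₁(r) = ∑ c_n n rⁿ⁻¹`
  (`hasDerivAt_hyperg`), and `W₁` is differentiable with derivative `W₂(r) = ∑ c_n n(n-1) rⁿ⁻²`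
  (`hasDerivAt_hypergDeriv`) — Mathlib's `hasDerivAt_tsum_of_isPreconnected` on `(-ρ, ρ)`,
  `|r| < ρ < 1`, with the summable weights `n ρⁿ⁻¹`, `n(n-1)ρⁿ⁻²` (the coefficients are bounded);
* **the hypergeometric equation** `r(1-r) W₂ + (7/2 - (5/2) r) W₁ + w = 0`
  (`hyperg_ode`; `a = -1/2`, `b = 2`, `c = 7/2`: `c - (a+b+1) r = 7/2 - 5r/2`, `-ab = +1`):
  term-wise the coefficient of `rᵐ` is `(m+1)(m+7/2) c_{m+1} - (m-1/2)(m+2) c_m = 0`, the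
  coefficient recursion `coeff_succ`, summed by telescoping — the pattern of the tree's
  `Literature.Probability.RandomPlanarGeometry.hypHalfGen_ode` (which treats `c = 1/2`).

Source: the hypergeometric differential equation (Andrews–Askey–Roy 1999, eq. (2.3.5)); proofs
are elementary power-series calculus. No definitions (the derivative series are written out as
`tsum`s).
-/

noncomputable section

open Filter Topology Set
open scoped Nat

namespace Summit.CriticalPhenomena.SAWScalingLimit.Theorems.CardyFSpec

/-! ### Summable weights -/

/-- `∑ n ρⁿ⁻¹` converges for `|ρ| < 1`. [folklore] -/
theorem summable_nat_mul_pow_pred {ρ : ℝ} (hρ : |ρ| < 1) :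
    Summable fun n : ℕ ↦ (n : ℝ) * ρ ^ (n - 1) := by
  rw [← summable_nat_add_iff 1]
  have hρ' : ‖ρ‖ < 1 := by simpa using hρ
  have h1 := summable_pow_mul_geometric_of_norm_lt_one 1 hρ'
  have h0 := summable_geometric_of_norm_lt_one hρ'
  simp only [pow_one] at h1
  refine (h1.add h0).congr fun n ↦ ?_
  simp only [Nat.add_sub_cancel]
  push_cast
  ring

/-- `∑ n (n-1) ρⁿ⁻²` converges for `|ρ| < 1`. [folklore] -/
theorem summable_nat_mul_pred_mul_pow {ρ : ℝ} (hρ : |ρ| < 1) :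
    Summable fun n : ℕ ↦ (n : ℝ) * (((n - 1 : ℕ) : ℝ) * ρ ^ (n - 1 - 1)) := by
  rw [← summable_nat_add_iff 2]
  have hρ' : ‖ρ‖ < 1 := by simpa using hρ
  have h2 := summable_pow_mul_geometric_of_norm_lt_one 2 hρ'
  have h1 := summable_pow_mul_geometric_of_norm_lt_one 1 hρ'
  have h0 := summable_geometric_of_norm_lt_one hρ'
  simp only [pow_one] at h1
  refine ((h2.add (h1.mul_left 3)).add (h0.mul_left 2)).congr fun n ↦ ?_
  simp only [Nat.add_sub_cancel, show n + 2 - 1 = n + 1 from rfl]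
  push_cast
  ring

/-! ### Term-wise differentiation -/

/-- **Term-wise differentiation of `₂F₁(-1/2, 2; 7/2; ·)`** on `|r| < 1`: the derivative is
`W₁(r) = ∑ c_n n rⁿ⁻¹`. [cite: AndrewsAskeyRoy1999, Def. 2.1.5] -/
theorem hasDerivAt_hyperg {r : ℝ} (hr : |r| < 1) :
    HasDerivAt (fun x ↦ ₂F₁ (-1 / 2 : ℝ) 2 (7 / 2) x)
      (∑' n : ℕ, ordinaryHypergeometricCoefficient (-1 / 2 : ℝ) 2 (7 / 2) n *
        ((n : ℝ) * r ^ (n - 1))) r := by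
  obtain ⟨ρ, hrρ, hρ1⟩ := exists_between hr
  have hρ0 : 0 ≤ ρ := (abs_nonneg r).trans hrρ.le
  have hρpos : 0 < ρ := (abs_nonneg r).trans_lt hrρ
  have hρ' : |ρ| < 1 := by rwa [abs_of_nonneg hρ0]
  have hfun : (fun x ↦ ₂F₁ (-1 / 2 : ℝ) 2 (7 / 2) x) =
      fun x ↦ ∑' n, ordinaryHypergeometricCoefficient (-1 / 2 : ℝ) 2 (7 / 2) n * x ^ n :=
    funext hyperg_eq_tsum
  rw [hfun]
  have hc1 : ∀ n, |ordinaryHypergeometricCoefficient (-1 / 2 : ℝ) 2 (7 / 2) n| ≤ 1 :=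
    abs_coeff_le_one
  have hs0 := summable_coeff_mul_pow (u := 0) (by simp)
  set c : ℕ → ℝ := ordinaryHypergeometricCoefficient (-1 / 2 : ℝ) 2 (7 / 2) with hc
  refine hasDerivAt_tsum_of_isPreconnected (u := fun n : ℕ ↦ (n : ℝ) * ρ ^ (n - 1))
    (t := Ioo (-ρ) ρ) (y₀ := 0) (summable_nat_mul_pow_pred hρ') isOpen_Ioo
    (convex_Ioo _ _).isPreconnected (fun n y _ ↦ (hasDerivAt_pow n y).const_mul (c n))
    (fun n y hy ↦ ?_) ⟨by linarith, hρpos⟩ ?_ (abs_lt.1 hrρ)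
  · have hy' : |y| ≤ ρ := (abs_lt.2 hy).le
    rw [Real.norm_eq_abs, abs_mul, abs_mul (n : ℝ), abs_pow, Nat.abs_cast]
    calc |c n| * ((n : ℝ) * |y| ^ (n - 1))
        ≤ 1 * ((n : ℝ) * ρ ^ (n - 1)) :=
          mul_le_mul (hc1 n) (by gcongr) (by positivity) zero_le_one
      _ = (n : ℝ) * ρ ^ (n - 1) := one_mul _
  · simpa using hs0

/-- **Term-wise differentiation of `W₁ = ∑ c_n n rⁿ⁻¹`** on `|r| < 1`: the derivative is
`W₂(r) = ∑ c_n n (n-1) rⁿ⁻²`. [cite: AndrewsAskeyRoy1999, Def. 2.1.5] -/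
theorem hasDerivAt_hypergDeriv {r : ℝ} (hr : |r| < 1) :
    HasDerivAt (fun x ↦ ∑' n : ℕ, ordinaryHypergeometricCoefficient (-1 / 2 : ℝ) 2 (7 / 2) n *
        ((n : ℝ) * x ^ (n - 1)))
      (∑' n : ℕ, ordinaryHypergeometricCoefficient (-1 / 2 : ℝ) 2 (7 / 2) n *
        ((n : ℝ) * (((n - 1 : ℕ) : ℝ) * r ^ (n - 1 - 1)))) r := by
  obtain ⟨ρ, hrρ, hρ1⟩ := exists_between hr
  have hρ0 : 0 ≤ ρ := (abs_nonneg r).trans hrρ.le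
  have hρpos : 0 < ρ := (abs_nonneg r).trans_lt hrρ
  have hρ' : |ρ| < 1 := by rwa [abs_of_nonneg hρ0]
  have hc1 : ∀ n, |ordinaryHypergeometricCoefficient (-1 / 2 : ℝ) 2 (7 / 2) n| ≤ 1 :=
    abs_coeff_le_one
  set c : ℕ → ℝ := ordinaryHypergeometricCoefficient (-1 / 2 : ℝ) 2 (7 / 2) with hc
  refine hasDerivAt_tsum_of_isPreconnected
    (u := fun n : ℕ ↦ (n : ℝ) * (((n - 1 : ℕ) : ℝ) * ρ ^ (n - 1 - 1)))
    (t := Ioo (-ρ) ρ) (y₀ := 0) (summable_nat_mul_pred_mul_pow hρ') isOpen_Ioo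
    (convex_Ioo _ _).isPreconnected
    (fun n y _ ↦ ((hasDerivAt_pow (n - 1) y).const_mul (n : ℝ)).const_mul (c n))
    (fun n y hy ↦ ?_) ⟨by linarith, hρpos⟩ ?_ (abs_lt.1 hrρ)
  · have hy' : |y| ≤ ρ := (abs_lt.2 hy).le
    rw [Real.norm_eq_abs, abs_mul, abs_mul (n : ℝ), abs_mul (((n - 1 : ℕ) : ℝ)), abs_pow,
      Nat.abs_cast, Nat.abs_cast]
    calc |c n| * ((n : ℝ) * (((n - 1 : ℕ) : ℝ) * |y| ^ (n - 1 - 1)))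
        ≤ 1 * ((n : ℝ) * (((n - 1 : ℕ) : ℝ) * ρ ^ (n - 1 - 1))) :=
          mul_le_mul (hc1 n) (by gcongr) (by positivity) zero_le_one
      _ = (n : ℝ) * (((n - 1 : ℕ) : ℝ) * ρ ^ (n - 1 - 1)) := one_mul _
  · refine Summable.of_norm_bounded (summable_nat_mul_pow_pred (ρ := 0) (by simp)) fun n ↦ ?_
    rw [Real.norm_eq_abs, abs_mul, abs_mul (n : ℝ), Nat.abs_cast, abs_pow, abs_zero]
    calc |c n| * ((n : ℝ) * 0 ^ (n - 1))
        ≤ 1 * ((n : ℝ) * 0 ^ (n - 1)) :=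
          mul_le_mul_of_nonneg_right (hc1 n) (by positivity)
      _ = (n : ℝ) * 0 ^ (n - 1) := one_mul _

/-- `HasSum (c_n n rⁿ⁻¹) (W₁ r)` for `|r| < 1`. [folklore] -/
theorem hasSum_hypergDeriv {r : ℝ} (hr : |r| < 1) :
    HasSum (fun n : ℕ ↦ ordinaryHypergeometricCoefficient (-1 / 2 : ℝ) 2 (7 / 2) n *
        ((n : ℝ) * r ^ (n - 1)))
      (∑' n : ℕ, ordinaryHypergeometricCoefficient (-1 / 2 : ℝ) 2 (7 / 2) n *
        ((n : ℝ) * r ^ (n - 1))) := by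
  have hc1 : ∀ n, |ordinaryHypergeometricCoefficient (-1 / 2 : ℝ) 2 (7 / 2) n| ≤ 1 :=
    abs_coeff_le_one
  set c : ℕ → ℝ := ordinaryHypergeometricCoefficient (-1 / 2 : ℝ) 2 (7 / 2) with hc
  have hr' : |(|r|)| < 1 := by rwa [abs_abs]
  have hs : Summable fun n : ℕ ↦ c n * ((n : ℝ) * r ^ (n - 1)) := by
    refine Summable.of_norm_bounded (summable_nat_mul_pow_pred hr') fun n ↦ ?_
    rw [Real.norm_eq_abs, abs_mul, abs_mul (n : ℝ), abs_pow, Nat.abs_cast]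
    calc |c n| * ((n : ℝ) * |r| ^ (n - 1))
        ≤ 1 * ((n : ℝ) * |r| ^ (n - 1)) :=
          mul_le_mul_of_nonneg_right (hc1 n) (by positivity)
      _ = (n : ℝ) * |r| ^ (n - 1) := one_mul _
  exact hs.hasSum

/-- `HasSum (c_n n (n-1) rⁿ⁻²) (W₂ r)` for `|r| < 1`. [folklore] -/
theorem hasSum_hypergDeriv₂ {r : ℝ} (hr : |r| < 1) :
    HasSum (fun n : ℕ ↦ ordinaryHypergeometricCoefficient (-1 / 2 : ℝ) 2 (7 / 2) n *
        ((n : ℝ) * (((n - 1 : ℕ) : ℝ) * r ^ (n - 1 - 1))))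
      (∑' n : ℕ, ordinaryHypergeometricCoefficient (-1 / 2 : ℝ) 2 (7 / 2) n *
        ((n : ℝ) * (((n - 1 : ℕ) : ℝ) * r ^ (n - 1 - 1)))) := by
  have hc1 : ∀ n, |ordinaryHypergeometricCoefficient (-1 / 2 : ℝ) 2 (7 / 2) n| ≤ 1 :=
    abs_coeff_le_one
  set c : ℕ → ℝ := ordinaryHypergeometricCoefficient (-1 / 2 : ℝ) 2 (7 / 2) with hc
  have hr' : |(|r|)| < 1 := by rwa [abs_abs]
  have hs : Summable fun n : ℕ ↦ c n * ((n : ℝ) * (((n - 1 : ℕ) : ℝ) * r ^ (n - 1 - 1))) := by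
    refine Summable.of_norm_bounded (summable_nat_mul_pred_mul_pow hr') fun n ↦ ?_
    rw [Real.norm_eq_abs, abs_mul, abs_mul (n : ℝ), abs_mul (((n - 1 : ℕ) : ℝ)), abs_pow,
      Nat.abs_cast, Nat.abs_cast]
    calc |c n| * ((n : ℝ) * (((n - 1 : ℕ) : ℝ) * |r| ^ (n - 1 - 1)))
        ≤ 1 * ((n : ℝ) * (((n - 1 : ℕ) : ℝ) * |r| ^ (n - 1 - 1))) :=
          mul_le_mul_of_nonneg_right (hc1 n) (by positivity)
      _ = (n : ℝ) * (((n - 1 : ℕ) : ℝ) * |r| ^ (n - 1 - 1)) := one_mul _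
  exact hs.hasSum

/-! ### The hypergeometric equation -/

/-- **The hypergeometric equation for `₂F₁(-1/2, 2; 7/2; ·)`**:
`r(1-r) W₂ + (7/2 - (5/2) r) W₁ + w = 0` on `|r| < 1` (`a = -1/2`, `b = 2`, `c = 7/2`; term-wise
the coefficient of `rᵐ` is `(m+1)(m+7/2) c_{m+1} - (m-1/2)(m+2) c_m = 0`, the recursion
`coeff_succ`, summed by telescoping). [cite: AndrewsAskeyRoy1999, Thm 2.3.1] -/
theorem hyperg_ode {r : ℝ} (hr : |r| < 1) :
    r * (1 - r) * (∑' n : ℕ, ordinaryHypergeometricCoefficient (-1 / 2 : ℝ) 2 (7 / 2) n *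
        ((n : ℝ) * (((n - 1 : ℕ) : ℝ) * r ^ (n - 1 - 1)))) +
      (7 / 2 - 5 / 2 * r) * (∑' n : ℕ, ordinaryHypergeometricCoefficient (-1 / 2 : ℝ) 2 (7 / 2) n *
        ((n : ℝ) * r ^ (n - 1))) +
      ₂F₁ (-1 / 2 : ℝ) 2 (7 / 2) r = 0 := by
  set c : ℕ → ℝ := fun n ↦ ordinaryHypergeometricCoefficient (-1 / 2 : ℝ) 2 (7 / 2) n with hc
  set W₁ : ℝ := ∑' n : ℕ, c n * ((n : ℝ) * r ^ (n - 1)) with hW₁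
  set W₂ : ℝ := ∑' n : ℕ, c n * ((n : ℝ) * (((n - 1 : ℕ) : ℝ) * r ^ (n - 1 - 1))) with hW₂
  have S0 : HasSum (fun n ↦ c n * r ^ n) (₂F₁ (-1 / 2 : ℝ) 2 (7 / 2) r) := hasSum_hyperg hr.le
  have S1 : HasSum (fun n : ℕ ↦ c n * ((n : ℝ) * r ^ (n - 1))) W₁ := hasSum_hypergDeriv hr
  have S2 : HasSum (fun n : ℕ ↦ c n * ((n : ℝ) * (((n - 1 : ℕ) : ℝ) * r ^ (n - 1 - 1)))) W₂ :=
    hasSum_hypergDeriv₂ hr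
  set A : ℕ → ℝ := fun n ↦ c n * ((n : ℝ) * (((n - 1 : ℕ) : ℝ) + 7 / 2)) * r ^ (n - 1) with hA
  set B : ℕ → ℝ := fun n ↦ c n * (((n : ℝ) + (-1 / 2)) * ((n : ℝ) + 2)) * r ^ n with hB
  have hAsum : HasSum A (r * W₂ + 7 / 2 * W₁) := by
    have h := (S2.mul_left r).add (S1.mul_left (7 / 2))
    have hfun : (fun n : ℕ ↦ r * (c n * ((n : ℝ) * (((n - 1 : ℕ) : ℝ) * r ^ (n - 1 - 1)))) +
        7 / 2 * (c n * ((n : ℝ) * r ^ (n - 1)))) = A := by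
      funext n
      simp only [hA]
      rcases n with _ | _ | m
      · simp
      · simp
        ring
      · simp only [Nat.add_sub_cancel, show m + 2 - 1 = m + 1 from rfl]
        push_cast
        ring
    rwa [hfun] at h
  have hA0 : A 0 = 0 := by simp [hA]
  have hBA : ∀ n, B n = A (n + 1) := by
    intro n
    simp only [hA, hB, Nat.add_sub_cancel, hc, coeff_succ]
    have h1 : (7 / 2 + (n : ℝ)) ≠ 0 := by positivity
    have h2 : ((n : ℝ) + 1) ≠ 0 := by positivity
    push_cast
    field_simp
    ring
  have hBsum : HasSum B (r * W₂ + 7 / 2 * W₁) := by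
    have h := (hasSum_nat_add_iff' 1).2 hAsum
    rw [Finset.sum_range_one, hA0, sub_zero] at h
    have hfun : (fun n ↦ A (n + 1)) = B := funext fun n ↦ (hBA n).symm
    rwa [hfun] at h
  have hT : HasSum (fun n ↦ A n - B n)
      (r * (1 - r) * W₂ + (7 / 2 - 5 / 2 * r) * W₁ + ₂F₁ (-1 / 2 : ℝ) 2 (7 / 2) r) := by
    have h := ((S2.mul_left (r * (1 - r))).add (S1.mul_left (7 / 2 - 5 / 2 * r))).add S0
    have hfun : (fun n : ℕ ↦
        r * (1 - r) * (c n * ((n : ℝ) * (((n - 1 : ℕ) : ℝ) * r ^ (n - 1 - 1)))) +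
          (7 / 2 - 5 / 2 * r) * (c n * ((n : ℝ) * r ^ (n - 1))) + c n * r ^ n) =
        fun n ↦ A n - B n := by
      funext n
      simp only [hA, hB]
      rcases n with _ | _ | m
      · simp
      · simp
        ring
      · simp only [Nat.add_sub_cancel, show m + 2 - 1 = m + 1 from rfl]
        push_cast
        ring
    rwa [hfun] at h
  have h0 : HasSum (fun n ↦ A n - B n) 0 := by
    simpa using hAsum.sub hBsum
  exact hT.unique h0

end Summit.CriticalPhenomena.SAWScalingLimit.Theorems.CardyFSpec
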